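import Literature.AlgebraicGeometry.Frobenioids.FiberProducts
import Literature.AlgebraicGeometry.Frobenioids.IsometricPreStepsPullback
import HarnessLib

/-!
# Frobenioids I, Proposition 1.6 (vi), clause «Aut^sub-ample»: the repaired (true) form — transfer
# along pull-back lifts

Mochizuki, *The geometry of Frobenioids I: the general theory*, Kyushu J. Math. **62** (2008)
293–400, §1, Proposition 1.6 (vi), kurims text p. 28 [cite: MochizukiFrdI2008, Prop. 1.6(vi) p.28]
("(vi) A object of `C′` is Aut-ample (respectively, Aut^sub-ample; End-ample) if it projects to such
an object of `C`").

The printed clause «Aut^sub-ample» (`PreFrobenioid.Prop16viAutSubAmpleIf`) is FALSE as printed under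
the cell's typing (kernel witness `SubAmpleTest.not_prop16viAutSubAmpleIf`,
`AutSubAmpleFiberProductCounterexample.lean`, seat abc-iut-found gen 2): a `C`-witness of the lifted
sub-automorphism and a `D′`-witness of the given one need not have matching bases.  THIS FILE records
the REPAIRED form that the lifting argument does prove (OURS, not a statement of the paper): if every
sub-automorphism of `A_D` lifts to a PULL-BACK endomorphism of `A` (Def. 1.2 (ii)), then every object
`(A, A′, α)` of `C′ = C ×_D D′` over `A` is `Aut^sub`-ample — the `D′`-witness `(B′, φ′, β′)` of
`f ∈ Aut^sub_{D′}(A′)` is lifted CARTESIANLY: a pull-back morphism `φ : W → A` over `D′→D (φ′)`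
(Def. 1.3 (i)(c)) and the pull-back property of `φ` give an endomorphism `β` of `W` over `D′→D (β′)` with
`φ ∘ β = a ∘ φ`, which is a base-isomorphic pull-back morphism (two out of three), i.e. an isomorphism
(Remark 1.2.1); `((W, B′), (φ, φ′), (β, β′))` is then a witness in `C′`.  Elementary Frobenioids satisfy
the hypothesis (pull-back morphisms of `F_Φ` = linear isometries, Prop. 1.5), consistently with
Prop. 1.5 (i).  Nothing here bears on [IUTchIII] Cor. 3.12.
-/

namespace Literature.AlgebraicGeometry.Frobenioids

open CategoryTheory Opposite

universe w v v' v'' u u' u''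

namespace PreFrobenioid

variable {D : Type u} [Category.{v} D] {D' : Type u'} [Category.{v'} D']
  {Φ : Dᵒᵖ ⥤ CommMonCat.{w}} {C : Type u''} [Category.{v''} C]
  {F : C ⥤ ElemFrobenioid Φ} {G : D' ⥤ D}

/-- The image under `D′ → D` of a sub-automorphism of `A′`, conjugated to `A_D` along
`α : A_D ≅ D′→D (A′)`, is a sub-automorphism of `A_D`. [cite: MochizukiFrdI2008, §0 p.14] -/
theorem conj_map_mem_autSub (X : FiberProduct F G) {f' : X.snd ⟶ X.snd} (hf' : f' ∈ autSub X.snd) :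
    X.e.hom ≫ G.map f' ≫ X.e.inv ∈ autSub (baseObj F X.fst) := by
  obtain ⟨B', φ', β', hw'⟩ := hf'
  refine ⟨G.obj B', G.map φ' ≫ X.e.inv, G.mapIso β', ?_⟩
  rw [Functor.mapIso_hom, ← Category.assoc, ← G.map_comp, hw', G.map_comp, Category.assoc,
    Category.assoc, Iso.inv_hom_id_assoc]

/-- **Prop. 1.6 (vi), clause «Aut^sub-ample», REPAIRED form (OURS):** if every sub-automorphism of
`A_D` lifts to a pull-back endomorphism of `A`, then every object of `C′ = C ×_D D′` projecting to `A`
is `Aut^sub`-ample (`C → F_Φ` a Frobenioid; no hypothesis on `D′ → D`).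
[cite: MochizukiFrdI2008, Prop. 1.6(vi) p.28] -/
theorem isAutSubAmple_fiberProduct_of_pullback_lifts (hF : IsFrobenioid F) (X : FiberProduct F G)
    (h : ∀ f ∈ autSub (baseObj F X.fst), ∃ a : X.fst ⟶ X.fst, IsPullbackMorphism F a ∧ Base F a = f) :
    IsAutSubAmple (fiberProductFunctor F G) X := by
  intro f' hf'
  change X.snd ⟶ X.snd at f'
  obtain ⟨a, ha, hab⟩ := h _ (conj_map_mem_autSub X hf')
  obtain ⟨B', φ', β', hw'⟩ := hf'
  change B' ⟶ X.snd at φ'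
  replace hw' : β'.hom ≫ φ' = φ' ≫ f' := hw'
  -- a pull-back morphism `φ : W → A` over `D′→D (φ′) ∘ α⁻¹`
  obtain ⟨W, φ, ω, hφ, hφb⟩ := exists_isPullbackMorphism_over hF X.fst (G.map φ' ≫ X.e.inv)
  -- the cartesian lift of `a ∘ φ` along `φ` over `ω ∘ D′→D (β′) ∘ ω⁻¹`
  have hb : Base F (φ ≫ a) = (ω.hom ≫ G.map β'.hom ≫ ω.inv) ≫ Base F φ := by
    rw [base_comp, hab, hφb]
    simp only [Category.assoc, Iso.inv_hom_id_assoc]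
    rw [← G.map_comp_assoc, ← G.map_comp_assoc, hw']
  obtain ⟨β, hβφ, hβb⟩ := hφ.exists_lift (φ ≫ a) (ω.hom ≫ G.map β'.hom ≫ ω.inv) hb
  -- `β` is a base-isomorphic pull-back morphism (two out of three), hence an isomorphism
  have hβpb : IsPullbackMorphism F β :=
    IsPullbackMorphism.of_comp F hφ (by rw [hβφ]; exact hφ.comp F ha)
  haveI : IsIso (Base F β) := by rw [hβb]; infer_instance
  haveI : IsIso β := (isPullbackMorphism_and_isBaseIso_iff_isIso F β).mp ⟨hβpb, ‹IsIso (Base F β)›⟩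
  -- the witness `((W, B′, ω), (φ, φ′), (β, β′))` in `C′`
  have wψ : Base F φ ≫ X.e.hom = ω.hom ≫ G.map φ' := by
    rw [hφb]; simp only [Category.assoc, Iso.inv_hom_id, Category.comp_id]
  have wβ : Base F β ≫ ω.hom = ω.hom ≫ G.map β'.hom := by
    rw [hβb]; simp only [Category.assoc, Iso.inv_hom_id, Category.comp_id]
  have wa : Base F a ≫ X.e.hom = X.e.hom ≫ G.map f' := by
    rw [hab]; simp only [Category.assoc, Iso.inv_hom_id, Category.comp_id]
  let Y : FiberProduct F G := ⟨W, B', ω⟩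
  let ψ : Y ⟶ X := ⟨φ, φ', wψ⟩
  refine ⟨⟨a, f', wa⟩, ⟨Y, ψ, CFP.isoMk (X := Y) (Y := Y) (asIso β) β' wβ, ?_⟩, rfl⟩
  exact CFP.hom_ext hβφ hw'

end PreFrobenioid

end Literature.AlgebraicGeometry.Frobenioids
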